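import Summits.ABC.ABC.Theses.DefiniteXi
import Summits.ABC.ABC.Theorems.StewartYuHolds
import Literature.NumberTheory.EllipticCurves.Szpiro
import Literature.NumberTheory.EllipticCurves.SzpiroSixFifthsProofs
import Literature.NumberTheory.DiophantineGeometry.AbcWave0
import Literature.NumberTheory.DiophantineGeometry.StrongHall
import Literature.Barriers.ABC.BakerMethodBounds
import HarnessLib

/-!
# Stub ideation k=3, GEN 4 (family 3: PROBE THE EXTREMES) — typed helpers for
`stub_primeToSixDegreeBound` (P6) of `Cruxes/SteinbergCore/Lines/p6_tamagawa_split.lean`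

Companion to `STUB-IDEAS-stub_primeToSixDegreeBound-3.md` (gen 4).  Gens 2/3 of this seat stand by
reference (`SketchStubIdeas3.lean`, ns `…StubIdeas3`: Plans A/B/C♯/D/E, `SixSmoothCredit ⟹ Stub ⟹
SixSmoothCreditPow`, census instrument `SixLocal`).  Gen 4 closes the two remaining EXTREMES of the
signature that gens 1–3 left qualitative:

* **the exponent extreme** — the ladder `P6κ κ` (`cps(deg_min) ≤ C_ε N^{κ+ε}`; `κ = 2` IS the stub,
  `Iff.rfl`): which rungs are theorems NOW, which are Szpiro-strength, which is abc.  Typed and partly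
  PROVED: `p6κ_mono`, `stub_iff_p6κ_two`, `stub_of_stubZero`; the transport
  `p6κ_of_freyHeightLe : (∀θ>0, MinimalDegUpper θ) → FreyHeightLe κ₀ → P6κ (1+κ₀)` (M); the rungs
  `freyHeightLe_sixFifths_of_szpiro` (S, tree-PROVED `abc_sixFifths_of_szpiro_holds`) ⇒ `κ = 11/5`
  from Szpiro, `freyHeightLe_one_of_abcLe` (S) ⇒ `κ = 2` from abc, and the UNCONDITIONAL log-rung
  `logRung_of_stewartYu : MinimalDegUpper 1 → stewart_yu → LogRung` (M; `stewart_yu_holds` is a tree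
  theorem, `MinimalDegUpper θ` is k2-PROVED from the named facts `FreyManinBound`/`exists_isNewformOf`).
* **the binder-free floor** — `deg D ≥ k·max(|a|,|b|)^{2/3}` for EVERY datum of EVERY Frey model
  (S, from the tree theorem `XiBoundSzpiroBootstrap.abs_Δ_le_mul_deg_pow_six`), whence
  `Stub ∧ SixSubpoly ∧ FreyModularity ⟹ FreyHeightLe 3` (M): even with the trivial Petersson bound the
  stub carries POLYNOMIAL abc (exponent 3) on Frey triples modulo the six law — open, beyond
  `Literature.Barriers.ABC.BakerMethodBounds`.
* **the `ε = 0` endpoint** `StubZero` (typed; open both ways — see the MD for the Masser-scale count).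

Every helper keeps the minimality binder and `0 < ε` where the stub has them (Disproof:
`primeToSixDegreeBound_false_without_minimality` p162897, `_false_without_eps_pos` p163062); none is an
instance of a landed `Negative/` lemma.  Sorries = exactly the one-cycle helpers marked (S)/(M).
-/
noncomputable section

set_option linter.dupNamespace false

open IsDedekindDomain WeierstrassCurve
open Literature.NumberTheory.EllipticCurves Literature.NumberTheory.EllipticCurves.ModularForms
open Literature.NumberTheory Literature.NumberTheory.DiophantineGeometry
open UniqueFactorizationMonoid

namespace Summit.ABC.ABC.Cruxes.SteinbergCore.StubIdeas3G4

/-! ## The stub, verbatim -/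

/-- The registered stub `stub_primeToSixDegreeBound`, verbatim. -/
def Stub : Prop :=
  ∀ ε : ℝ, 0 < ε → ∃ C : ℝ, ∀ a b : ℤ, IsCoprime a b → a * b * (a + b) ≠ 0 → ∀ (N : ℕ) [NeZero N],
    (freyCurve a b).conductorNorm ℤ = N →
    ∀ D : ModularParametrizationData (freyCurve a b) N,
      (∀ D' : ModularParametrizationData (freyCurve a b) N, D.deg ≤ D'.deg) →
      ((D.deg / (ordProj[2] D.deg * ordProj[3] D.deg) : ℕ) : ℝ) ≤ C * (N : ℝ) ^ (2 + ε)

/-- Certificate: `Stub` is syntactically the registered signature (fully qualified form). -/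
example : Stub ↔
    (∀ ε : ℝ, 0 < ε → ∃ C : ℝ, ∀ a b : ℤ, IsCoprime a b → a * b * (a + b) ≠ 0 → ∀ (N : ℕ) [NeZero N],
      (Literature.NumberTheory.EllipticCurves.freyCurve a b).conductorNorm ℤ = N →
      ∀ D : Literature.NumberTheory.EllipticCurves.ModularForms.ModularParametrizationData
        (Literature.NumberTheory.EllipticCurves.freyCurve a b) N,
        (∀ D' : Literature.NumberTheory.EllipticCurves.ModularForms.ModularParametrizationData
          (Literature.NumberTheory.EllipticCurves.freyCurve a b) N, D.deg ≤ D'.deg) →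
        ((D.deg / (ordProj[2] D.deg * ordProj[3] D.deg) : ℕ) : ℝ) ≤ C * (N : ℝ) ^ (2 + ε)) :=
  Iff.rfl

/-- k3 gen-2 `MinimalDegUpper θ` verbatim (= k2's PROVED `MinimalDegUpperOn (fun _ => True) θ` up to the
trivial `True →`): a MINIMAL datum of the Frey model has `deg ≤ K · N^{1+θ} · max(|a|,|b|)`; abc-free,
from `FreyManinBound` + `exists_isNewformOf` (k2 g2 `minimalDegUpperOn_all`, 0 sorry). -/
def MinimalDegUpper (θ : ℝ) : Prop :=
  ∃ K : ℝ, ∀ a b : ℤ, IsCoprime a b → a * b * (a + b) ≠ 0 → ∀ (N : ℕ) [NeZero N],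
    (freyCurve a b).conductorNorm ℤ = N → ∀ D : ModularParametrizationData (freyCurve a b) N,
      (∀ D' : ModularParametrizationData (freyCurve a b) N, D.deg ≤ D'.deg) →
      (D.deg : ℝ) ≤ K * (N : ℝ) ^ (1 + θ) * max (|(a : ℝ)|) (|(b : ℝ)|)

/-! ## §1  The exponent ladder `P6κ` -/

/-- **`P6κ κ`**: the stub with conductor exponent `κ + ε` in place of `2 + ε` (same binders). -/
def P6κ (κ : ℝ) : Prop :=
  ∀ ε : ℝ, 0 < ε → ∃ C : ℝ, ∀ a b : ℤ, IsCoprime a b → a * b * (a + b) ≠ 0 → ∀ (N : ℕ) [NeZero N],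
    (freyCurve a b).conductorNorm ℤ = N →
    ∀ D : ModularParametrizationData (freyCurve a b) N,
      (∀ D' : ModularParametrizationData (freyCurve a b) N, D.deg ≤ D'.deg) →
      ((D.deg / (ordProj[2] D.deg * ordProj[3] D.deg) : ℕ) : ℝ) ≤ C * (N : ℝ) ^ (κ + ε)

/-- The stub IS the rung `κ = 2`. -/
theorem stub_iff_p6κ_two : Stub ↔ P6κ 2 := Iff.rfl

/-- The ladder is monotone (PROVED): `N ≥ 1`. -/
theorem p6κ_mono {κ κ' : ℝ} (hκ : κ ≤ κ') (h : P6κ κ) : P6κ κ' := by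
  intro ε hε
  obtain ⟨C, hC⟩ := h ε hε
  refine ⟨max C 0, fun a b hab h0 N _ hN D hD => ?_⟩
  have h1 := hC a b hab h0 N hN D hD
  have hN1 : (1 : ℝ) ≤ (N : ℝ) := by exact_mod_cast Nat.one_le_iff_ne_zero.mpr (NeZero.ne N)
  calc ((D.deg / (ordProj[2] D.deg * ordProj[3] D.deg) : ℕ) : ℝ) ≤ C * (N : ℝ) ^ (κ + ε) := h1
    _ ≤ max C 0 * (N : ℝ) ^ (κ + ε) :=
        mul_le_mul_of_nonneg_right (le_max_left _ _) (Real.rpow_nonneg (Nat.cast_nonneg _) _)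
    _ ≤ max C 0 * (N : ℝ) ^ (κ' + ε) :=
        mul_le_mul_of_nonneg_left (Real.rpow_le_rpow_of_exponent_le hN1 (by linarith))
          (le_max_right _ _)

/-- **`FreyHeightLe κ₀`** — the Diophantine currency of the ladder: `max(|a|,|b|) ≤ C_ε N(E_{a,b})^{κ₀+ε}`
for all coprime `a, b` with `ab(a+b) ≠ 0`.  `κ₀ = 1` is abc on Frey triples (`rad(ab(a+b)) ∣ 2N`,
`N ∣ 2⁸·rad`), `κ₀ = 6/5` follows from Szpiro (tree-PROVED `abc_sixFifths_of_szpiro_holds`), no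
`κ₀` is known (`Literature.Barriers.ABC.BakerMethodBounds`: only `log max ≪ N^{1/3}(log N)^3`). -/
def FreyHeightLe (κ₀ : ℝ) : Prop :=
  ∀ ε : ℝ, 0 < ε → ∃ C : ℝ, ∀ a b : ℤ, IsCoprime a b → a * b * (a + b) ≠ 0 →
    max (|(a : ℝ)|) (|(b : ℝ)|) ≤ C * (((freyCurve a b).conductorNorm ℤ : ℕ) : ℝ) ^ (κ₀ + ε)

/-- **A2 (M, one cycle) — the transport.**  `cps(deg_min) ≤ deg_min ≤ K N^{1+θ} H ≤ K C N^{1+θ+κ₀+ε'}`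
with `θ = ε' = ε/2`; `Nat.div_le_self`, `Real.rpow_add` on `1 ≤ N`, constants `max · 0`. -/
theorem p6κ_of_freyHeightLe {κ₀ : ℝ} (hκ₀ : 0 ≤ κ₀) (hB : ∀ θ : ℝ, 0 < θ → MinimalDegUpper θ)
    (hH : FreyHeightLe κ₀) : P6κ (1 + κ₀) := by
  sorry

/-- abc, `≤`-form with exponent `1+ε` (k3 gen-2 shape, = the hypothesis of `DiophantineGeometry.abc_int_of_abcLe`). -/
def AbcLe : Prop :=
  ∀ ε : ℝ, 0 < ε → ∃ C : ℝ, ∀ a b c : ℕ, IsABCTriple a b c →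
    (c : ℝ) ≤ C * ((rad a b c : ℕ) : ℝ) ^ (1 + ε)

/-- **A3a (S) — rung `κ₀ = 1` from abc.**  `abc_int_of_abcLe` (signed bookkeeping, tree) +
`radical_natAbs_dvd_two_mul_conductorNorm_freyCurve` (`rad(ab(a+b)) ≤ 2N`, tree) + `(2N)^{1+ε} ≤ 2^{1+ε} N^{1+ε}`. -/
theorem freyHeightLe_one_of_abcLe (habc : AbcLe) : FreyHeightLe 1 := by
  sorry

/-- **A3b (S) — rung `κ₀ = 6/5` from Szpiro.**  `abc_sixFifths_of_szpiro_holds hSz : ∀ε>0 ∃C, c ≤ C rad^{6/5+ε}`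
(tree THEOREM, `SzpiroSixFifthsProofs`), then the same signed bookkeeping as `abc_int_of_abcLe` with
exponent `6/5 + ε` and `rad ≤ 2N`. -/
theorem freyHeightLe_sixFifths_of_szpiro (hSz : SzpiroConjecture) : FreyHeightLe (6 / 5) := by
  sorry

/-- Rung `κ = 2` (the stub) from abc — PROVED modulo A2/A3a (cf. k3 gen-2 `stub_of_abcLe`, tree
`abcLe_imp_freyDegreeConjecture_of_petersson_of_manin`). -/
theorem stub_of_abcLe (hB : ∀ θ : ℝ, 0 < θ → MinimalDegUpper θ) (habc : AbcLe) : Stub := by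
  rw [stub_iff_p6κ_two, show (2 : ℝ) = 1 + 1 by norm_num]
  exact p6κ_of_freyHeightLe zero_le_one hB (freyHeightLe_one_of_abcLe habc)

/-- **Rung `κ = 11/5` from Szpiro** — PROVED modulo A2/A3b.  (The elementary route `H⁴ ≤ 2¹⁰|Δ_min|`
gives only `κ = 5/2`; the tree's `6/5` theorem is sharper.) -/
theorem p6κ_elevenFifths_of_szpiro (hB : ∀ θ : ℝ, 0 < θ → MinimalDegUpper θ)
    (hSz : SzpiroConjecture) : P6κ (11 / 5) := by
  rw [show (11 / 5 : ℝ) = 1 + 6 / 5 by norm_num]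
  exact p6κ_of_freyHeightLe (by norm_num) hB (freyHeightLe_sixFifths_of_szpiro hSz)

/-- **`LogRung`** — the unconditional end of the ladder: `log deg_min(E_{a,b}) ≤ C (N^{1/3}(log N)^3 + 1)`
(a fortiori for `cps(deg_min)`).  Shape `(θ, m) = (1/3, 3)` of `Literature.Barriers.ABC.BakerShapeBound`;
the same proof turns any `BakerShapeBound θ m` into the `(θ, m)` log-rung. -/
def LogRung : Prop :=
  ∃ C : ℝ, ∀ a b : ℤ, IsCoprime a b → a * b * (a + b) ≠ 0 → ∀ (N : ℕ) [NeZero N],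
    (freyCurve a b).conductorNorm ℤ = N →
    ∀ D : ModularParametrizationData (freyCurve a b) N,
      (∀ D' : ModularParametrizationData (freyCurve a b) N, D.deg ≤ D'.deg) →
      Real.log (D.deg : ℝ) ≤ C * ((N : ℝ) ^ (1 / 3 : ℝ) * Real.log (N : ℝ) ^ 3 + 1)

/-- **A4a (S) — Stewart–Yu for signed triples** (pattern: `abc_int_of_bakerShapeBound_zero_one` /
`abc_int_of_abcLe`: arrange signs so the two summands of equal sign are the `a, b` of an abc triple). -/
theorem stewartYu_int (h : stewart_yu) :
    ∃ C : ℝ, 0 ≤ C ∧ ∀ A B D : ℤ, A ≠ 0 → B ≠ 0 → D ≠ 0 → IsCoprime A B → A + B + D = 0 →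
      Real.log (A.natAbs : ℝ) ≤ C * ((radical (A * B * D).natAbs : ℕ) : ℝ) ^ (1 / 3 : ℝ) *
          Real.log ((radical (A * B * D).natAbs : ℕ) : ℝ) ^ 3 ∧
      Real.log (B.natAbs : ℝ) ≤ C * ((radical (A * B * D).natAbs : ℕ) : ℝ) ^ (1 / 3 : ℝ) *
          Real.log ((radical (A * B * D).natAbs : ℕ) : ℝ) ^ 3 := by
  sorry

/-- **A4 (M, one cycle) — the unconditional log-rung.**  `deg_min ≤ K N² H` (`MinimalDegUpper 1`),
`log H ≤ C₀ R^{1/3}(log R)^3` (A4a, `R = rad|ab(a+b)| ≤ 2N` by `radical_natAbs_dvd_two_mul_conductorNorm_freyCurve`),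
`log K + 2 log N ≤ C'(N^{1/3}(log N)^3 + 1)` (`Real.log_le_rpow_div`-type absorption); template = tree
`exists_log_minimalDiscriminantNorm_freyCurve_le_stewartYu` (`Summits/ABC/Analytic/GlueDegree.lean`). -/
theorem logRung_of_stewartYu (hB : MinimalDegUpper 1) (h : stewart_yu) : LogRung := by
  sorry

/-- The log-rung modulo the one abc-free input `MinimalDegUpper 1` (Stewart–Yu is the tree theorem
`Summit.ABC.ABC.Theorems.stewart_yu_holds`). -/
theorem logRung_of_minimalDegUpper (hB : MinimalDegUpper 1) : LogRung :=
  logRung_of_stewartYu hB Summit.ABC.ABC.Theorems.stewart_yu_holds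

/-! ## §2  The binder-free archimedean floor and its payoff -/

/-- **A5 (S, one cycle) — the floor.**  EVERY modular parametrisation datum of the Frey MODEL `E_{a,b}`
(any level) has `deg ≥ k · max(|a|,|b|)^{2/3}`: `|Δ(E_{a,b})| = 16 (ab(a+b))² ≤ K₀ deg⁶` (tree
`XiBoundSzpiroBootstrap.abs_Δ_le_mul_deg_pow_six` + `abs_cast_Δ_freyCurve`) and `|ab(a+b)| ≥ H²/2`
(`|a| ≤ |b| = H`: if `|a| ≥ H/2` use `|a+b| ≥ 1`, else `|a+b| ≥ H/2`).  No modularity, no Manin, no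
Petersson binder (the trivial `(f,f) ≥ e^{-4π}/4π` is inside the tree theorem). -/
theorem deg_ge_heightTwoThirds :
    ∃ k : ℝ, 0 < k ∧ ∀ a b : ℤ, a * b * (a + b) ≠ 0 → ∀ (N : ℕ) [NeZero N]
      (D : ModularParametrizationData (freyCurve a b) N),
      k * (max (|(a : ℝ)|) (|(b : ℝ)|)) ^ (2 / 3 : ℝ) ≤ (D.deg : ℝ) := by
  sorry

/-- **`SixSubpoly`** — the global shadow of gen-3's census instrument `SixLocal` (six law:
`six(deg_min) = 4^{ω(N)}·six(∏_q v_q(Δ_min))·2^{O(1)} = (NH)^{o(1)}`): the `6`-smooth part of the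
minimal degree is sub-polynomial in `N·H`.  Hypothesis only (crux-A / census territory), never sorried. -/
def SixSubpoly : Prop :=
  ∀ η : ℝ, 0 < η → ∃ C : ℝ, ∀ a b : ℤ, IsCoprime a b → a * b * (a + b) ≠ 0 → ∀ (N : ℕ) [NeZero N],
    (freyCurve a b).conductorNorm ℤ = N →
    ∀ D : ModularParametrizationData (freyCurve a b) N,
      (∀ D' : ModularParametrizationData (freyCurve a b) N, D.deg ≤ D'.deg) →
      ((ordProj[2] D.deg * ordProj[3] D.deg : ℕ) : ℝ) ≤
        C * (N : ℝ) ^ η * (max (|(a : ℝ)|) (|(b : ℝ)|)) ^ η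

/-- **A6 (M) — binder-free payoff.**  `Stub ∧ SixSubpoly ∧ FreyModularity ⟹ FreyHeightLe 3`
(polynomial abc, exponent 3, on Frey triples): a minimal datum exists (`FreyModularity` + well-ordering,
k2 g3 `exists_minimal_datum`), `k H^{2/3} ≤ deg_min = cps·six ≤ C₁N^{2+ε₁} · C₂ N^η H^η` (A5,
`Nat.div_mul_cancel (six_dvd)`), so `H^{2/3-η} ≤ C N^{2+ε₁+η}`; take `η, ε₁` small against `ε`.
Calibration: gen-3 Plan A reaches exponent `1` but needs the route binder `PeterssonLowerBound`; A6
needs nothing and still lands beyond `BakerMethodBounds` — the stub is polynomial-abc-hard even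
stripped of every analytic binder. -/
theorem freyHeightLe_three_of_stub (hmod : Summit.ABC.ABC.Theses.DefiniteXi.FreyModularity)
    (h : Stub) (hsix : SixSubpoly) : FreyHeightLe 3 := by
  sorry

/-! ## §3  The `ε = 0` endpoint -/

/-- **`StubZero`** — the stub at `ε = 0`: ONE constant, `cps(deg_min) ≤ C N²`.  Open both ways: not
refuted by `Literature.Barriers.ABC.SzpiroEpsilonCannotBeDropped` / `EpsilonCannotBeDropped` (their
Masser/Stewart–Tijdeman families give `H/N ≥ exp((4-δ)√(log N)/log log N)` but the transport to
`cps(deg_min)` loses `≈ 8^{ω(N)}` at the same scale — see the MD), not implied by abc. -/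
def StubZero : Prop :=
  ∃ C : ℝ, ∀ a b : ℤ, IsCoprime a b → a * b * (a + b) ≠ 0 → ∀ (N : ℕ) [NeZero N],
    (freyCurve a b).conductorNorm ℤ = N →
    ∀ D : ModularParametrizationData (freyCurve a b) N,
      (∀ D' : ModularParametrizationData (freyCurve a b) N, D.deg ≤ D'.deg) →
      ((D.deg / (ordProj[2] D.deg * ordProj[3] D.deg) : ℕ) : ℝ) ≤ C * (N : ℝ) ^ (2 : ℝ)

/-- The endpoint gives the stub (PROVED): `N² ≤ N^{2+ε}` for `N ≥ 1`. -/
theorem stub_of_stubZero (h : StubZero) : Stub := by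
  intro ε hε
  obtain ⟨C, hC⟩ := h
  refine ⟨max C 0, fun a b hab h0 N _ hN D hD => ?_⟩
  have h1 := hC a b hab h0 N hN D hD
  have hN1 : (1 : ℝ) ≤ (N : ℝ) := by exact_mod_cast Nat.one_le_iff_ne_zero.mpr (NeZero.ne N)
  calc ((D.deg / (ordProj[2] D.deg * ordProj[3] D.deg) : ℕ) : ℝ) ≤ C * (N : ℝ) ^ (2 : ℝ) := h1
    _ ≤ max C 0 * (N : ℝ) ^ (2 : ℝ) :=
        mul_le_mul_of_nonneg_right (le_max_left _ _) (Real.rpow_nonneg (Nat.cast_nonneg _) _)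
    _ ≤ max C 0 * (N : ℝ) ^ (2 + ε) :=
        mul_le_mul_of_nonneg_left (Real.rpow_le_rpow_of_exponent_le hN1 (by linarith))
          (le_max_right _ _)

/-- `StubZero` is the rung-`2` statement WITHOUT the `ε`: it implies every `P6κ κ`, `κ ≥ 2` (PROVED). -/
theorem p6κ_of_stubZero {κ : ℝ} (hκ : 2 ≤ κ) (h : StubZero) : P6κ κ :=
  p6κ_mono hκ (stub_iff_p6κ_two.mp (stub_of_stubZero h))

/-- **A7 (S) — the bottom of the ladder is refutable.**  For `κ < 0`, `P6κ κ` fails: at `ε = -κ/2` the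
bound is `C N^{κ/2} < 1 ≤ cps(deg_min)` once `N` is large, and Frey conductors are unbounded (an odd
prime `q ∣ ab(a+b)` divides `N`, `radical_natAbs_dvd_two_mul_conductorNorm_freyCurve`; take
`(a, b) = (1, q - 1)`); a datum exists by `FreyModularity` (without it `P6κ κ` is vacuous — the same
binder the Disproof's `_false_without_eps_pos` (ε = −3) uses).  The window `0 ≤ κ < 2` is OPEN: it
needs an upper bound on the `6`-part of `deg_min` (crux A / `SixSubpoly`). -/
theorem not_p6κ_of_neg (hmod : Summit.ABC.ABC.Theses.DefiniteXi.FreyModularity) {κ : ℝ}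
    (hκ : κ < 0) : ¬ P6κ κ := by
  sorry

end Summit.ABC.ABC.Cruxes.SteinbergCore.StubIdeas3G4

end
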